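import Mathlib
import HarnessLib

/-!
# Route `IsogenyRedei` — support item `SliceFrame` (stmt-Parity-14953): the cofactor bound

Step (i-b) of `SliceFrame`, asymptotic form: if the parity function `(−1)^{ω(n²+1)}` has a
Siegel–Walfisz-rate bound along progressions at the single exponent `A = 20`
(`|∑_{n ≤ y, n ≡ c (Q)} (−1)^{ω(n²+1)}| ≤ C y/(log y)^{20}` for `Q ≤ (log y)^{20}`, `y ≥ x₀`), then
for every fixed cofactor modulus `e ≥ 1`,
`A_e(y) = ∑_{n ≤ y, e ∣ n²+1} μ((n²+1)/e) = O_e(y/(log y)²)` (`cofactor_sum_bound`).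
This is `abs_cofactor_sum_le` (hypothesis `hsieve`, with its own inputs already discharged) with
`R = ⌈(log y)^6⌉`, `Z = y^{3/5}`, `B = C y/(log y)^{20}` and the root-class constant of
`exists_card_sq_dvd_le` (hypothesis `hcount`): the four terms are `8e²C·y/(log y)²`,
`4C₂·y/(log y)³`, `C₂ y^{9/10}` and `≤ 4 y^{4/5} log y`.  The two inputs are hypotheses only so
that this file elaborates against Mathlib oleans alone; the frame file discharges them.
-/

namespace Summit.Parity.BatemanHorn.Theorems.SliceFrame

open Finset Filter Asymptotics

open scoped ArithmeticFunction.Moebius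

/-- `⌊log₃ y⌋ ≤ log y` for `y ≥ 1`. [folklore] -/
theorem natLog_three_le_log {y : ℕ} (hy : 1 ≤ y) : (Nat.log 3 y : ℝ) ≤ Real.log y := by
  have h3 : (1 : ℝ) ≤ Real.log 3 := by
    rw [← Real.log_exp 1]
    refine Real.log_le_log (Real.exp_pos 1) ?_
    have := Real.exp_one_lt_d9
    linarith
  have hpow : ((3 ^ Nat.log 3 y : ℕ) : ℝ) ≤ y := by exact_mod_cast Nat.pow_log_le_self 3 (by omega)
  have hlog := Real.log_le_log (by positivity) hpow
  push_cast at hlog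
  rw [Real.log_pow] at hlog
  calc (Nat.log 3 y : ℝ) = Nat.log 3 y * 1 := (mul_one _).symm
    _ ≤ Nat.log 3 y * Real.log 3 := mul_le_mul_of_nonneg_left h3 (Nat.cast_nonneg _)
    _ ≤ Real.log y := hlog

/-- The two growth facts used below, packaged along `ℕ`: eventually
`(log y)² ≤ y^{1/10}` and `4 (log y)³ ≤ y^{1/5}`. [folklore] -/
theorem eventually_log_pow_le_rpow :
    ∀ᶠ y : ℕ in atTop, Real.log y ^ 2 ≤ (y : ℝ) ^ (1 / 10 : ℝ)
      ∧ 4 * Real.log y ^ 3 ≤ (y : ℝ) ^ (1 / 5 : ℝ) := by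
  have h1 := (isLittleO_log_rpow_rpow_atTop (s := 1 / 10) 2 (by norm_num)).comp_tendsto
    tendsto_natCast_atTop_atTop
  have h2 := (isLittleO_log_rpow_rpow_atTop (s := 1 / 5) 3 (by norm_num)).comp_tendsto
    tendsto_natCast_atTop_atTop
  have h1' := h1.bound (c := 1) one_pos
  have h2' := h2.bound (c := 1 / 4) (by norm_num)
  filter_upwards [h1', h2', eventually_ge_atTop 3] with y hy1 hy2 hy3
  have hy0 : (0 : ℝ) ≤ Real.log y := Real.log_nonneg (by exact_mod_cast (by omega : 1 ≤ y))
  simp only [Function.comp_apply, one_mul] at hy1 hy2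
  rw [Real.norm_of_nonneg (Real.rpow_nonneg hy0 _),
    Real.norm_of_nonneg (Real.rpow_nonneg (Nat.cast_nonneg _) _)] at hy1 hy2
  have e2 : Real.log y ^ (2 : ℝ) = Real.log y ^ 2 := by exact_mod_cast Real.rpow_natCast _ 2
  have e3 : Real.log y ^ (3 : ℝ) = Real.log y ^ 3 := by exact_mod_cast Real.rpow_natCast _ 3
  rw [e2] at hy1
  rw [e3] at hy2
  exact ⟨hy1, by linarith⟩

/-- **The cofactor bound (step (i-b) of `SliceFrame`).** From the parity input at exponent
`20`, for every `e ≥ 1` there are `K, y₀` with `|∑_{n ≤ y, e ∣ n²+1} μ((n²+1)/e)| ≤ K y/(log y)²`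
for all `y ≥ y₀` (`hcount` = `exists_card_sq_dvd_le`, `hsieve` = `abs_cofactor_sum_le …` of the
sieve file, verbatim). [folklore] -/
theorem cofactor_sum_bound
    (hcount : ∃ C₂ : ℝ, 0 < C₂ ∧ ∀ r : ℕ, 1 ≤ r → ∀ y : ℕ,
      (((Finset.Icc 1 y).filter (fun n : ℕ => r ^ 2 ∣ n ^ 2 + 1)).card : ℝ)
        ≤ C₂ * Real.sqrt r * (((y : ℝ) + 1) / (r : ℝ) ^ 2 + 1))
    (hsieve : ∀ {e y R : ℕ}, 1 ≤ e → 1 ≤ R → ∀ {Z B C₂ : ℝ}, 1 ≤ Z → 0 ≤ C₂ →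
      (∀ r : ℕ, 1 ≤ r → ∀ y : ℕ,
        (((Finset.Icc 1 y).filter (fun n : ℕ => r ^ 2 ∣ n ^ 2 + 1)).card : ℝ)
          ≤ C₂ * Real.sqrt r * (((y : ℝ) + 1) / (r : ℝ) ^ 2 + 1)) →
      (∀ Q : ℕ, 1 ≤ Q → Q ≤ e ^ 2 * R ^ 2 → ∀ c : ℕ,
        |∑ n ∈ (Finset.Icc 1 y).filter (fun n : ℕ => n ≡ c [MOD Q]),
          (-1 : ℝ) ^ (n ^ 2 + 1).primeFactors.card| ≤ B) →
      |∑ n ∈ (Finset.Icc 1 y).filter (fun n : ℕ => e ∣ n ^ 2 + 1), (μ ((n ^ 2 + 1) / e) : ℝ)|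
        ≤ (R : ℝ) * ((e : ℝ) ^ 2 * (R : ℝ) ^ 2 * B) + C₂ * ((y : ℝ) + 1) * (2 / Real.sqrt R)
          + Z * (C₂ * Real.sqrt Z) + ((y : ℝ) ^ 2 + 1) / Z ^ 2 * (Nat.log 3 y + 1))
    (hP : ∃ C : ℝ, ∃ x₀ : ℕ, ∀ x : ℕ, x₀ ≤ x → ∀ q : ℕ, 1 ≤ q → (q : ℝ) ≤ Real.log x ^ (20 : ℝ) →
      ∀ a : ℕ, |∑ n ∈ (Finset.Icc 1 x).filter (fun n : ℕ => n ≡ a [MOD q]),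
        (-1 : ℝ) ^ (n ^ 2 + 1).primeFactors.card| ≤ C * (x : ℝ) / Real.log x ^ (20 : ℝ))
    {e : ℕ} (he : 1 ≤ e) :
    ∃ K : ℝ, ∃ y₀ : ℕ, ∀ y : ℕ, y₀ ≤ y →
      |∑ n ∈ (Finset.Icc 1 y).filter (fun n : ℕ => e ∣ n ^ 2 + 1), (μ ((n ^ 2 + 1) / e) : ℝ)|
        ≤ K * (y : ℝ) / Real.log y ^ 2 := by
  obtain ⟨C, x₀, hC⟩ := hP
  obtain ⟨C₂, hC₂0, hC₂⟩ := hcount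
  -- the threshold
  have hev : ∀ᶠ y : ℕ in atTop, x₀ ≤ y ∧ 2 * (e : ℝ) ≤ Real.log y ∧
      (Real.log y ^ 2 ≤ (y : ℝ) ^ (1 / 10 : ℝ) ∧ 4 * Real.log y ^ 3 ≤ (y : ℝ) ^ (1 / 5 : ℝ)) := by
    refine (eventually_ge_atTop x₀).and ((?_ : ∀ᶠ y : ℕ in atTop, _).and
      eventually_log_pow_le_rpow)
    have := (Real.tendsto_log_atTop.comp tendsto_natCast_atTop_atTop).eventually_ge_atTop
      (2 * (e : ℝ))
    filter_upwards [this] with y hy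
    exact hy
  obtain ⟨y₀, hy₀⟩ := Filter.eventually_atTop.mp hev
  refine ⟨8 * (e : ℝ) ^ 2 * C + 4 * C₂ + C₂ + 1, y₀, fun y hy => ?_⟩
  obtain ⟨hyx₀, hye, hgrow1, hgrow2⟩ := hy₀ y hy
  -- basic facts about `L = log y`
  set L := Real.log (y : ℝ) with hL
  have he1 : (1 : ℝ) ≤ e := by exact_mod_cast he
  have hL2 : 2 ≤ L := by linarith
  have hL1 : 1 ≤ L := by linarith
  have hL0 : 0 < L := by linarith
  have hy1 : (1 : ℝ) < y := by
    by_contra h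
    push Not at h
    have : L ≤ 0 := Real.log_nonpos (Nat.cast_nonneg _) h
    linarith
  have hy1' : 1 ≤ y := by exact_mod_cast hy1.le
  have hy0 : (0 : ℝ) < y := by linarith
  -- parameters
  set R : ℕ := ⌈L ^ 6⌉₊ with hR
  set Z : ℝ := (y : ℝ) ^ (3 / 5 : ℝ) with hZ
  set B : ℝ := C * (y : ℝ) / L ^ (20 : ℝ) with hB
  have hL6 : 1 ≤ L ^ 6 := one_le_pow₀ hL1
  have hR1 : 1 ≤ R := Nat.one_le_iff_ne_zero.mpr (Nat.ceil_pos.mpr (by linarith)).ne'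
  have hRge : L ^ 6 ≤ R := Nat.le_ceil _
  have hRle : (R : ℝ) ≤ 2 * L ^ 6 := by
    have := Nat.ceil_lt_add_one (by positivity : (0 : ℝ) ≤ L ^ 6)
    rw [← hR] at this
    linarith
  have hZ1 : 1 ≤ Z := Real.one_le_rpow hy1.le (by norm_num)
  -- the parity input, for the moduli `Q ≤ e² R²`
  have hL20 : L ^ (20 : ℝ) = L ^ 20 := by exact_mod_cast Real.rpow_natCast L 20
  have hmod : ((e ^ 2 * R ^ 2 : ℕ) : ℝ) ≤ L ^ 20 := by
    have h8 : 4 * (e : ℝ) ^ 2 ≤ L ^ 8 := by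
      have : (2 * (e : ℝ)) ^ 8 ≤ L ^ 8 := pow_le_pow_left₀ (by positivity) hye 8
      nlinarith [pow_le_pow_left₀ (by positivity) he1 8, pow_le_pow_left₀ (by positivity) he1 2,
        pow_nonneg (by positivity : (0:ℝ) ≤ e) 8]
    calc ((e ^ 2 * R ^ 2 : ℕ) : ℝ) = (e : ℝ) ^ 2 * (R : ℝ) ^ 2 := by push_cast; ring
      _ ≤ (e : ℝ) ^ 2 * (2 * L ^ 6) ^ 2 := by gcongr
      _ = 4 * (e : ℝ) ^ 2 * L ^ 12 := by ring
      _ ≤ L ^ 8 * L ^ 12 := by gcongr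
      _ = L ^ 20 := by ring
  have hBQ : ∀ Q : ℕ, 1 ≤ Q → Q ≤ e ^ 2 * R ^ 2 → ∀ c : ℕ,
      |∑ n ∈ (Finset.Icc 1 y).filter (fun n : ℕ => n ≡ c [MOD Q]),
        (-1 : ℝ) ^ (n ^ 2 + 1).primeFactors.card| ≤ B := by
    intro Q hQ1 hQle c
    refine hC y hyx₀ Q hQ1 ?_ c
    rw [hL20]
    exact le_trans (by exact_mod_cast hQle) hmod
  have hB0 : 0 ≤ B := (abs_nonneg _).trans (hBQ 1 le_rfl (Nat.one_le_iff_ne_zero.mpr (by positivity)) 0)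
  -- the pointwise sieve bound
  have hmain := hsieve (y := y) (B := B) he hR1 hZ1 hC₂0.le hC₂ hBQ
  refine hmain.trans ?_
  -- term 1
  have hC0 : 0 ≤ C := by
    by_contra h
    push Not at h
    have hneg : C * (y : ℝ) / L ^ (20 : ℝ) < 0 := by
      rw [hL20]
      exact div_neg_of_neg_of_pos (mul_neg_of_neg_of_pos h hy0) (by positivity)
    have hB0' := hB0
    simp only [hB] at hB0'
    linarith
  have ht1 : (R : ℝ) * ((e : ℝ) ^ 2 * (R : ℝ) ^ 2 * B) ≤ 8 * (e : ℝ) ^ 2 * C * ((y : ℝ) / L ^ 2) := by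
    have hR3 : (R : ℝ) ^ 3 ≤ 8 * L ^ 18 := by
      calc (R : ℝ) ^ 3 ≤ (2 * L ^ 6) ^ 3 := pow_le_pow_left₀ (Nat.cast_nonneg _) hRle 3
        _ = 8 * L ^ 18 := by ring
    have hBval : B = C * (y : ℝ) / L ^ 20 := by rw [hB, hL20]
    calc (R : ℝ) * ((e : ℝ) ^ 2 * (R : ℝ) ^ 2 * B) = (R : ℝ) ^ 3 * ((e : ℝ) ^ 2 * B) := by ring
      _ ≤ (8 * L ^ 18) * ((e : ℝ) ^ 2 * B) :=
          mul_le_mul_of_nonneg_right hR3 (by positivity)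
      _ = 8 * (e : ℝ) ^ 2 * C * ((y : ℝ) / L ^ 2) := by
          rw [hBval]
          field_simp
  -- term 2
  have ht2 : C₂ * ((y : ℝ) + 1) * (2 / Real.sqrt R) ≤ 4 * C₂ * ((y : ℝ) / L ^ 2) := by
    have hsqrt : L ^ 3 ≤ Real.sqrt R := by
      rw [show L ^ 3 = Real.sqrt ((L ^ 3) ^ 2) from (Real.sqrt_sq (by positivity)).symm]
      exact Real.sqrt_le_sqrt (by nlinarith)
    have hL3 : 0 < L ^ 3 := by positivity
    calc C₂ * ((y : ℝ) + 1) * (2 / Real.sqrt R)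
        ≤ C₂ * ((y : ℝ) + 1) * (2 / L ^ 3) := by gcongr
      _ ≤ C₂ * (2 * (y : ℝ)) * (2 / L ^ 3) := by gcongr; linarith
      _ = 4 * C₂ * ((y : ℝ) / L ^ 2) * (1 / L) := by field_simp; ring
      _ ≤ 4 * C₂ * ((y : ℝ) / L ^ 2) * 1 := by
          refine mul_le_mul_of_nonneg_left ?_ (by positivity)
          rw [div_le_one hL0]; exact hL1
      _ = 4 * C₂ * ((y : ℝ) / L ^ 2) := mul_one _
  -- term 3
  have ht3 : Z * (C₂ * Real.sqrt Z) ≤ C₂ * ((y : ℝ) / L ^ 2) := by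
    have hZ32 : Z * Real.sqrt Z = (y : ℝ) ^ (9 / 10 : ℝ) := by
      rw [hZ, Real.sqrt_eq_rpow, ← Real.rpow_mul hy0.le, ← Real.rpow_add hy0]
      norm_num
    have hkey : L ^ 2 * (y : ℝ) ^ (9 / 10 : ℝ) ≤ y := by
      calc L ^ 2 * (y : ℝ) ^ (9 / 10 : ℝ) ≤ (y : ℝ) ^ (1 / 10 : ℝ) * (y : ℝ) ^ (9 / 10 : ℝ) :=
            mul_le_mul_of_nonneg_right hgrow1 (Real.rpow_nonneg hy0.le _)
        _ = y := by rw [← Real.rpow_add hy0]; norm_num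
    calc Z * (C₂ * Real.sqrt Z) = C₂ * (Z * Real.sqrt Z) := by ring
      _ = C₂ * (y : ℝ) ^ (9 / 10 : ℝ) := by rw [hZ32]
      _ ≤ C₂ * ((y : ℝ) / L ^ 2) := by
          refine mul_le_mul_of_nonneg_left ?_ hC₂0.le
          rw [le_div_iff₀ (by positivity)]
          linarith
  -- term 4
  have ht4 : ((y : ℝ) ^ 2 + 1) / Z ^ 2 * (Nat.log 3 y + 1) ≤ (y : ℝ) / L ^ 2 := by
    have hZ2 : Z ^ 2 = (y : ℝ) ^ (6 / 5 : ℝ) := by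
      rw [hZ, ← Real.rpow_natCast, ← Real.rpow_mul hy0.le]; norm_num
    have hy45 : ((y : ℝ) ^ 2 + 1) / Z ^ 2 ≤ 2 * (y : ℝ) ^ (4 / 5 : ℝ) := by
      rw [hZ2, div_le_iff₀ (by positivity)]
      have : (y : ℝ) ^ (4 / 5 : ℝ) * (y : ℝ) ^ (6 / 5 : ℝ) = (y : ℝ) ^ 2 := by
        rw [← Real.rpow_add hy0, ← Real.rpow_natCast]; norm_num
      have hy2 : (1 : ℝ) ≤ (y : ℝ) ^ 2 := by nlinarith
      rw [mul_assoc, this]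
      linarith
    have hlog3 : (Nat.log 3 y : ℝ) + 1 ≤ 2 * L := by
      have := natLog_three_le_log hy1'
      rw [← hL] at this
      linarith
    have hkey : 4 * L ^ 3 * (y : ℝ) ^ (4 / 5 : ℝ) ≤ y := by
      calc 4 * L ^ 3 * (y : ℝ) ^ (4 / 5 : ℝ) ≤ (y : ℝ) ^ (1 / 5 : ℝ) * (y : ℝ) ^ (4 / 5 : ℝ) :=
            mul_le_mul_of_nonneg_right hgrow2 (Real.rpow_nonneg hy0.le _)
        _ = y := by rw [← Real.rpow_add hy0]; norm_num
    have hpos : (0 : ℝ) ≤ (y : ℝ) ^ (4 / 5 : ℝ) := Real.rpow_nonneg hy0.le _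
    calc ((y : ℝ) ^ 2 + 1) / Z ^ 2 * (Nat.log 3 y + 1)
        ≤ (2 * (y : ℝ) ^ (4 / 5 : ℝ)) * (2 * L) :=
          mul_le_mul hy45 hlog3 (by positivity) (by positivity)
      _ = (4 * L ^ 3 * (y : ℝ) ^ (4 / 5 : ℝ)) / L ^ 2 := by field_simp; ring
      _ ≤ (y : ℝ) / L ^ 2 := div_le_div_of_nonneg_right hkey (by positivity)
  have hfin : 8 * (e : ℝ) ^ 2 * C * ((y : ℝ) / L ^ 2) + 4 * C₂ * ((y : ℝ) / L ^ 2)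
      + C₂ * ((y : ℝ) / L ^ 2) + (y : ℝ) / L ^ 2
      = (8 * (e : ℝ) ^ 2 * C + 4 * C₂ + C₂ + 1) * (y : ℝ) / L ^ 2 := by ring
  linarith [ht1, ht2, ht3, ht4, hfin]

end Summit.Parity.BatemanHorn.Theorems.SliceFrame
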